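import Summits.AtomisticToContinuum.Crystallization.Theorems.FreeSplittingCertificatesStrictSplittingRuleP1ReadSummable

/-!
# `StrictSplittingRule` (stmt-AtomisticToContinuum-12560): the readout regrouping in DYAD form — `Σ_e w_e|ΔV_e|² ≤ Σ'_T Σᶠ_e θ_{eT} w_e |d_eᵀ G_T|²`, the form the certified per-cell budget (B) bounds by `λ_max` (P1 interpolant object, part 49)

Route `FreeSplittingCertificates`, crux r3 `StrictSplittingRule` (H12⋆ = `stub_coreJointCoercive`), unit b2b-freesplit-B gen 32.
VALUE = the (T5)/(T6) interface of the kernel assembly map (HOME FAR-LEMMA-SPEC §23 (b)) in the SHARP form the certificate uses.  Parts 37/40/48 bound the leg readouts by the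
crude capacity `|y_{q+s} − y_q|²·|G_T|²_F` (Cauchy–Schwarz per leg); the certified per-cell budget (B) (CERT §31: cellval rule v31 + celltail) is the SHARPER statement
`λ_max(S_T) + κ·radcoef·ρ_T I8_T ≤ κ(f/24)·I6_T` with the leg DYAD matrix `S_T = Σ_e θ_{eT} w_e d_e d_eᵀ`, i.e. `∀ G, Σ_e θ_{eT} w_e |d_eᵀ G|² ≤ (κ(f/24)I6_T − κ·radcoef·ρ_T I8_T)|G|²_F` —
which does NOT follow from a trace bound.  So the kernel chain must hand (B) the dyad form.  Here, for ANY share table with the carrier property: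
* `fpSq_readout_eq_dyad` — on a carrier cell the leg readout IS the dyad readout: `|V(q+s) − V q|² = |d_eᵀ G_T|²`, `d_e = y_{q+s} − y_q` (`p1CellVals_sub_eq_grad`);
* **`tsum_readout_leg_table_le_dyad`** — `Σ'_e w_e|V(q+s) − V q|² ≤ Σ'_T Σᶠ_e θ_{eT}·w_e·|d_eᵀ G_T|²` with the dyad cell family summable, for lattice values with bounded cell gradients
  and summable leg loads (abstract regrouping `tsum_le_tsum_regroup` of part 37; domination by the crude family of part 40);
* **`tsum_readout_leg_table_le_dyad_p1DispSite`** — the same for the far-ledger field `V = p1DispSite a h U b₀ A` (`G_T = G_T(U) − A`), no summability hypothesis.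
With part 48's routed leg weight this is the complete kernel side of (T5); (T6) then enters as the certificate-tier hypothesis `∀ T G, Σᶠ_e θ_{eT} w_e |d_eᵀG|² + c_T|G|²_F ≤ κ(f/24)I6_T|G|²_F`.
NOT a proof of H12⋆, NOT summit progress.  [folklore]
-/

noncomputable section

open Set Function
open scoped BigOperators

namespace Summit.AtomisticToContinuum.Crystallization.Theorems.StrictSplittingRuleBirth

open Literature.MathematicalPhysics.StatisticalMechanics
open Summit.AtomisticToContinuum.Crystallization.Theorems.PalmUnimodularRigidity.LayeredLawsSelectHcp

/-! ## The leg readout on a carrier cell is the dyad readout -/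

/-- **On a carrier cell the leg readout is the dyad readout**: if `e.1` and `e.1 + e.2` are the vertices `m, m'` of the cell `T`, then
`|V(e.1+e.2) − V e.1|² = |d_eᵀ G_T|²` with `d_e = y_{e.1+e.2} − y_{e.1}`, `G_T = p1CellGrad a h V T`. -/
theorem fpSq_readout_eq_dyad {a h : ℝ} (ha : a ≠ 0) (hh : h ≠ 0) (V : ℤ × ℤ × ℤ → (Fin 3 → ℝ)) (T : (ℤ × ℤ × ℤ) × Fin 6)
    {e : (ℤ × ℤ × ℤ) × (ℤ × ℤ × ℤ)} {m m' : Fin 4} (hm : e.1 = T.1 + p1VertOff (p1Par T.1) T.2 m)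
    (hm' : e.1 + e.2 = T.1 + p1VertOff (p1Par T.1) T.2 m') :
    fpSq (fun k => V (e.1 + e.2) k - V e.1 k) =
      fpSq (fun k => (hcpSite a h (e.1 + e.2) 0 - hcpSite a h e.1 0) * p1CellGrad a h V T 0 k +
        (hcpSite a h (e.1 + e.2) 1 - hcpSite a h e.1 1) * p1CellGrad a h V T 1 k +
        (hcpSite a h (e.1 + e.2) 2 - hcpSite a h e.1 2) * p1CellGrad a h V T 2 k) := by
  have hk : ∀ k, V (e.1 + e.2) k - V e.1 k =
      (hcpSite a h (e.1 + e.2) 0 - hcpSite a h e.1 0) * p1CellGrad a h V T 0 k +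
        (hcpSite a h (e.1 + e.2) 1 - hcpSite a h e.1 1) * p1CellGrad a h V T 1 k +
        (hcpSite a h (e.1 + e.2) 2 - hcpSite a h e.1 2) * p1CellGrad a h V T 2 k := by
    intro k
    have h1 := p1CellVals_sub_eq_grad ha hh V T m' m k
    simp only [p1CellVals] at h1
    rw [← hm, ← hm'] at h1
    exact h1
  simp only [hk]

/-! ## The regrouping in dyad form -/

/-- **THE READOUT REGROUPING OVER AN ALLOCATION TABLE, DYAD FORM**: legs `e = (q, s)`, nonnegative leg weights with summable loads, a nonnegative share table with finite sections,
unit row sums and the carrier property, lattice values `V` with bounded cell gradients.  Then the dyad cell family `T ↦ Σᶠ_e θ_{eT}·w_e·|d_eᵀ G_T|²` is summable and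
`Σ'_e w_e·|V(q+s) − V q|² ≤ Σ'_T Σᶠ_e θ_{eT}·w_e·|d_eᵀ G_T|²`.  NOT a proof of H12⋆, NOT summit progress. -/
theorem tsum_readout_leg_table_le_dyad {a h : ℝ} (ha : a ≠ 0) (hh : h ≠ 0) (V : ℤ × ℤ × ℤ → (Fin 3 → ℝ))
    (w : (ℤ × ℤ × ℤ) × (ℤ × ℤ × ℤ) → ℝ) (hw : ∀ e, 0 ≤ w e)
    (θ : (ℤ × ℤ × ℤ) × (ℤ × ℤ × ℤ) → (ℤ × ℤ × ℤ) × Fin 6 → ℝ) (hθ : ∀ e T, 0 ≤ θ e T)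
    (hfinE : ∀ e, (Function.support (θ e)).Finite) (hfinC : ∀ T, (Function.support fun e => θ e T).Finite)
    (hsum : ∀ e, ∑ᶠ T, θ e T = 1)
    (hcar : ∀ e T, θ e T ≠ 0 → ∃ m m' : Fin 4, e.1 = T.1 + p1VertOff (p1Par T.1) T.2 m ∧
      e.1 + e.2 = T.1 + p1VertOff (p1Par T.1) T.2 m')
    {B : ℝ} (hB : ∀ T, fpFrob (p1CellGrad a h V T) ≤ B)
    (hws : Summable fun e : (ℤ × ℤ × ℤ) × (ℤ × ℤ × ℤ) => w e * fpSq (fun k => hcpSite a h (e.1 + e.2) k - hcpSite a h e.1 k)) :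
    Summable (fun T : (ℤ × ℤ × ℤ) × Fin 6 => ∑ᶠ e : (ℤ × ℤ × ℤ) × (ℤ × ℤ × ℤ), θ e T * w e *
      fpSq (fun k => (hcpSite a h (e.1 + e.2) 0 - hcpSite a h e.1 0) * p1CellGrad a h V T 0 k +
        (hcpSite a h (e.1 + e.2) 1 - hcpSite a h e.1 1) * p1CellGrad a h V T 1 k +
        (hcpSite a h (e.1 + e.2) 2 - hcpSite a h e.1 2) * p1CellGrad a h V T 2 k)) ∧
    Summable (fun e : (ℤ × ℤ × ℤ) × (ℤ × ℤ × ℤ) => w e * fpSq (fun k => V (e.1 + e.2) k - V e.1 k)) ∧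
    ∑' e : (ℤ × ℤ × ℤ) × (ℤ × ℤ × ℤ), w e * fpSq (fun k => V (e.1 + e.2) k - V e.1 k) ≤
    ∑' T : (ℤ × ℤ × ℤ) × Fin 6, ∑ᶠ e : (ℤ × ℤ × ℤ) × (ℤ × ℤ × ℤ), θ e T * w e *
      fpSq (fun k => (hcpSite a h (e.1 + e.2) 0 - hcpSite a h e.1 0) * p1CellGrad a h V T 0 k +
        (hcpSite a h (e.1 + e.2) 1 - hcpSite a h e.1 1) * p1CellGrad a h V T 1 k +
        (hcpSite a h (e.1 + e.2) 2 - hcpSite a h e.1 2) * p1CellGrad a h V T 2 k) := by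
  -- the dyad readout of leg e against cell T, and the crude one
  set D : (ℤ × ℤ × ℤ) × (ℤ × ℤ × ℤ) → (ℤ × ℤ × ℤ) × Fin 6 → ℝ := fun e T =>
    fpSq (fun k => (hcpSite a h (e.1 + e.2) 0 - hcpSite a h e.1 0) * p1CellGrad a h V T 0 k +
      (hcpSite a h (e.1 + e.2) 1 - hcpSite a h e.1 1) * p1CellGrad a h V T 1 k +
      (hcpSite a h (e.1 + e.2) 2 - hcpSite a h e.1 2) * p1CellGrad a h V T 2 k) with hDdef
  set F : (ℤ × ℤ × ℤ) × (ℤ × ℤ × ℤ) → (ℤ × ℤ × ℤ) × Fin 6 → ℝ := fun e T => θ e T * w e * D e T with hFdef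
  have hD0 : ∀ e T, 0 ≤ D e T := fun e T => fpSq_nonneg _
  have hDle : ∀ e T, D e T ≤ fpSq (fun k => hcpSite a h (e.1 + e.2) k - hcpSite a h e.1 k) * fpFrob (p1CellGrad a h V T) := fun e T =>
    fpSq_vecMul_le (fun k => hcpSite a h (e.1 + e.2) k - hcpSite a h e.1 k) (p1CellGrad a h V T)
  have hF0 : ∀ e T, 0 ≤ F e T := fun e T => mul_nonneg (mul_nonneg (hθ e T) (hw e)) (hD0 e T)
  -- supports of F sit inside the supports of θ
  have hsuppE : ∀ e, Function.support (F e) ⊆ Function.support (θ e) := fun e T hT => by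
    simp only [Function.mem_support, ne_eq] at hT ⊢
    exact fun h0 => hT (by simp only [hFdef, h0, zero_mul])
  have hsuppC : ∀ T, (Function.support fun e => F e T) ⊆ Function.support fun e => θ e T := fun T e he => by
    simp only [Function.mem_support, ne_eq] at he ⊢
    exact fun h0 => he (by simp only [hFdef, h0, zero_mul])
  have hfinFE : ∀ e, (Function.support (F e)).Finite := fun e => (hfinE e).subset (hsuppE e)
  have hfinFC : ∀ T, (Function.support fun e => F e T).Finite := fun T => (hfinC T).subset (hsuppC T)
  -- termwise: w e R e = Σᶠ_T F e T  (exact identity on carrier cells, unit row sums)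
  have hle : ∀ e, w e * fpSq (fun k => V (e.1 + e.2) k - V e.1 k) ≤ ∑ᶠ T, F e T := by
    intro e
    have hterm : ∀ T, θ e T * (w e * fpSq (fun k => V (e.1 + e.2) k - V e.1 k)) = F e T := by
      intro T
      by_cases h0 : θ e T = 0
      · simp only [hFdef, h0, zero_mul]
      · obtain ⟨m, m', hm, hm'⟩ := hcar e T h0
        rw [hFdef, fpSq_readout_eq_dyad ha hh V T hm hm']
        ring
    calc w e * fpSq (fun k => V (e.1 + e.2) k - V e.1 k)
        = (∑ᶠ T, θ e T) * (w e * fpSq (fun k => V (e.1 + e.2) k - V e.1 k)) := by rw [hsum e, one_mul]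
      _ = ∑ᶠ T, θ e T * (w e * fpSq (fun k => V (e.1 + e.2) k - V e.1 k)) := finsum_mul' _ _ (hfinE e)
      _ = ∑ᶠ T, F e T := finsum_congr hterm
      _ ≤ ∑ᶠ T, F e T := le_rfl
  -- the dyad cell family is dominated by the crude cell family of part 40, hence summable
  have hcrude := summable_readout_cellFamily V w hw θ hθ hfinE hfinC hsum hB hws
  have hcell_le : ∀ T, ∑ᶠ e, F e T ≤
      (∑ᶠ e, θ e T * w e * fpSq (fun k => hcpSite a h (e.1 + e.2) k - hcpSite a h e.1 k)) * fpFrob (p1CellGrad a h V T) := by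
    intro T
    have hfin1 : (Function.support fun e => θ e T * w e * fpSq (fun k => hcpSite a h (e.1 + e.2) k - hcpSite a h e.1 k)).Finite :=
      (hfinC T).subset fun e he => by
        simp only [Function.mem_support, ne_eq] at he ⊢; exact fun h0 => he (by simp only [h0, zero_mul])
    have hfin2 : (Function.support fun e => θ e T * w e * fpSq (fun k => hcpSite a h (e.1 + e.2) k - hcpSite a h e.1 k) *
        fpFrob (p1CellGrad a h V T)).Finite :=
      (hfinC T).subset fun e he => by
        simp only [Function.mem_support, ne_eq] at he ⊢; exact fun h0 => he (by simp only [h0, zero_mul])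
    rw [finsum_mul' _ _ hfin1]
    refine finsum_le_finsum' (hfinFC T) hfin2 fun e => ?_
    calc F e T = θ e T * w e * D e T := rfl
      _ ≤ θ e T * w e * (fpSq (fun k => hcpSite a h (e.1 + e.2) k - hcpSite a h e.1 k) * fpFrob (p1CellGrad a h V T)) :=
          mul_le_mul_of_nonneg_left (hDle e T) (mul_nonneg (hθ e T) (hw e))
      _ = θ e T * w e * fpSq (fun k => hcpSite a h (e.1 + e.2) k - hcpSite a h e.1 k) * fpFrob (p1CellGrad a h V T) := by ring
  have hcell0 : ∀ T, 0 ≤ ∑ᶠ e, F e T := fun T => finsum_nonneg fun e => hF0 e T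
  have hs : Summable fun T => ∑ᶠ e, F e T := Summable.of_nonneg_of_le hcell0 hcell_le hcrude
  have hA0 : ∀ e : (ℤ × ℤ × ℤ) × (ℤ × ℤ × ℤ), 0 ≤ w e * fpSq (fun k => V (e.1 + e.2) k - V e.1 k) := fun e => mul_nonneg (hw e) (fpSq_nonneg _)
  obtain ⟨hsA, hineq⟩ := tsum_le_tsum_regroup _ F hA0 hF0 hfinFE hfinFC hle hs
  exact ⟨hs, hsA, hineq⟩

/-- **THE READOUT REGROUPING, DYAD FORM, FOR THE FAR-LEDGER FIELD**: `V = p1DispSite a h U b₀ A` (`U` finitely supported), `G_T = G_T(U) − A`; no summability hypothesis beyond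
summable leg loads.  NOT a proof of H12⋆, NOT summit progress. -/
theorem tsum_readout_leg_table_le_dyad_p1DispSite {a h : ℝ} (ha : 0 < a) (hh : 0 < h) (U : ℤ × ℤ × ℤ → (Fin 3 → ℝ))
    (hU : (support U).Finite) (b₀ : Fin 3 → ℝ) (A : Fin 3 → Fin 3 → ℝ)
    (w : (ℤ × ℤ × ℤ) × (ℤ × ℤ × ℤ) → ℝ) (hw : ∀ e, 0 ≤ w e)
    (θ : (ℤ × ℤ × ℤ) × (ℤ × ℤ × ℤ) → (ℤ × ℤ × ℤ) × Fin 6 → ℝ) (hθ : ∀ e T, 0 ≤ θ e T)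
    (hfinE : ∀ e, (Function.support (θ e)).Finite) (hfinC : ∀ T, (Function.support fun e => θ e T).Finite)
    (hsum : ∀ e, ∑ᶠ T, θ e T = 1)
    (hcar : ∀ e T, θ e T ≠ 0 → ∃ m m' : Fin 4, e.1 = T.1 + p1VertOff (p1Par T.1) T.2 m ∧
      e.1 + e.2 = T.1 + p1VertOff (p1Par T.1) T.2 m')
    (hws : Summable fun e : (ℤ × ℤ × ℤ) × (ℤ × ℤ × ℤ) => w e * fpSq (fun k => hcpSite a h (e.1 + e.2) k - hcpSite a h e.1 k)) :
    Summable (fun T : (ℤ × ℤ × ℤ) × Fin 6 => ∑ᶠ e : (ℤ × ℤ × ℤ) × (ℤ × ℤ × ℤ), θ e T * w e *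
      fpSq (fun k => (hcpSite a h (e.1 + e.2) 0 - hcpSite a h e.1 0) * (p1CellGrad a h U T 0 k - A 0 k) +
        (hcpSite a h (e.1 + e.2) 1 - hcpSite a h e.1 1) * (p1CellGrad a h U T 1 k - A 1 k) +
        (hcpSite a h (e.1 + e.2) 2 - hcpSite a h e.1 2) * (p1CellGrad a h U T 2 k - A 2 k))) ∧
    Summable (fun e : (ℤ × ℤ × ℤ) × (ℤ × ℤ × ℤ) =>
      w e * fpSq (fun k => p1DispSite a h U b₀ A (e.1 + e.2) k - p1DispSite a h U b₀ A e.1 k)) ∧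
    ∑' e : (ℤ × ℤ × ℤ) × (ℤ × ℤ × ℤ), w e * fpSq (fun k => p1DispSite a h U b₀ A (e.1 + e.2) k - p1DispSite a h U b₀ A e.1 k) ≤
    ∑' T : (ℤ × ℤ × ℤ) × Fin 6, ∑ᶠ e : (ℤ × ℤ × ℤ) × (ℤ × ℤ × ℤ), θ e T * w e *
      fpSq (fun k => (hcpSite a h (e.1 + e.2) 0 - hcpSite a h e.1 0) * (p1CellGrad a h U T 0 k - A 0 k) +
        (hcpSite a h (e.1 + e.2) 1 - hcpSite a h e.1 1) * (p1CellGrad a h U T 1 k - A 1 k) +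
        (hcpSite a h (e.1 + e.2) 2 - hcpSite a h e.1 2) * (p1CellGrad a h U T 2 k - A 2 k)) := by
  obtain ⟨B, hB⟩ := exists_bound_fpFrob_p1CellGrad_p1DispSite ha hh U hU b₀ A
  have hmain := tsum_readout_leg_table_le_dyad ha.ne' hh.ne' (fun n k => p1DispSite a h U b₀ A n k) w hw θ hθ hfinE hfinC hsum hcar hB hws
  simp only [p1CellGrad_p1DispSite ha hh] at hmain
  exact hmain

end Summit.AtomisticToContinuum.Crystallization.Theorems.StrictSplittingRuleBirth

end
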